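import Literature.MathematicalPhysics.QuantumFieldTheory.YangMillsOS
import Literature.MathematicalPhysics.QuantumLattice.RepLieAlgebraUnitary
import Mathlib.Analysis.Complex.Cardinality
import Mathlib.LinearAlgebra.Matrix.Permutation
import HarnessLib

/-!
# Inhabitedness of the carrier `LatticeRep G` (carrier census 2026-08-17, unit libB-QuantumFields-02)

`LatticeRep G` (file `YangMillsOS.lean`) is the DATA of a faithful continuous unitary matrix
representation `ρ : G →* M_N(ℂ)` of a topological group `G`; 179 route items of `QuantumFields`
bind `∀ r : LatticeRep G` after `∀ (G : Type) [Group G] [TopologicalSpace G] [IsTopologicalGroup G]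
[CompactSpace G]` (and often `IsCompactSimpleLieGroup G →`). The census could close neither
`∀ params, Nonempty (LatticeRep params)` nor its negation. This file settles both views.

## Findings (all proved below)

* **The uniform view is FALSE — and it is false INSIDE the items' telescope**
  (`LatticeRep.not_forall_nonempty`): `ℤ₂` with the indiscrete topology is a compact topological
  group with NO faithful continuous matrix representation. The exact obstruction region proved
  here: `LatticeRep G` is EMPTY whenever `G` is not Hausdorff (`isEmpty_of_not_t2Space`), not `T₁`
  (`isEmpty_of_not_t1Space`), or has more than continuum many elements
  (`isEmpty_of_continuum_lt_card`) — a faithful `ρ` embeds `G` into the Hausdorff space `M_N(ℂ)` of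
  cardinality `𝔠`. For compact `G` this is by design: `Nonempty (LatticeRep G)` is exactly the
  "linear = Lie" clause of `IsCompactSimpleLieGroup` (Bröcker–tom Dieck III (4.1) with I (3.11): a
  compact group has a faithful representation iff it is a Lie group), so over a non-Lie compact
  group an item `∀ r : LatticeRep G, …` is vacuous — correctly, since Wilson's lattice theory
  needs the "Tr".
  Conversely a compact `G` carrying a `LatticeRep` is automatically a (Hausdorff, second
  countable) topological GROUP (`LatticeRep.isTopologicalGroup`), so the `[IsTopologicalGroup G]`
  binder of the items is implied by the carrier.
* **The existential view is TRUE with the standard inhabitants** (explicit data, no choice):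
  `SU(N)` and `U(N)` in their defining representations (`fundamentalLatticeRep`,
  `unitaryFundamentalLatticeRep`, re-exported as `Nonempty` instances), `U(1) = Circle`
  (`LatticeRep.circle`), every FINITE group with the discrete topology via its regular
  representation by permutation matrices (`LatticeRep.regular`; Serre §1.2 (b), Bröcker–tom Dieck
  I (1.15) "every finite group is a zero-dimensional compact Lie group"), the trivial group
  (`LatticeRep.ofSubsingleton`), and closure under continuous injective pull-back / restriction to
  subgroups (`LatticeRep.comap`, `LatticeRep.restrict`). `LatticeRep.exists_nonempty` is the
  census' `∃ params` view inside the items' telescope (witness `SU(2)`).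
* For items guarded by `IsCompactSimpleLieGroup G →` the binder `∀ r : LatticeRep G` is never
  vacuous relative to the guard (`nonempty_of_isCompactSimpleLieGroup = And.right`); whether the
  guard itself is inhabited is the tree's (unproved) named fact
  `isSimpleCompactGroup_specialUnitaryGroup` (simplicity of `SU(n)`, `n ≥ 2`), see
  `exists_isCompactSimpleLieGroup_of`.

Sources. T. Bröcker, T. tom Dieck, *Representations of Compact Lie Groups* (1985), I (1.9)–(1.10)
(`U(n)`, `SU(n)`), I (1.15) (finite groups), III (4.1) (faithful representations);
J.-P. Serre, *Linear Representations of Finite Groups* (1977), §1.2 (b) (regular representation),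
§1.3 (unitarity). Everything in this file is proved; no named facts are introduced.
-/

noncomputable section

open scoped Cardinal
open Function Set

namespace Literature.MathematicalPhysics.QuantumFieldTheory

open _root_.Topology Literature.MathematicalPhysics.QuantumLattice

namespace LatticeRep

/-! ### Obstructions: where `LatticeRep G` is empty -/

section Obstructions

variable {G : Type*} [Group G] [TopologicalSpace G]

/-- **Emptiness region, I.** A non-Hausdorff topological group carries NO lattice representation
data: `LatticeRep G` is empty (a faithful `ρ` is a continuous injection into the Hausdorff space
`M_N(ℂ)`; no compactness needed — cf. `LatticeRep.t2Space` for the compact case). [folklore] -/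
theorem isEmpty_of_not_t2Space (h : ¬ T2Space G) : IsEmpty (LatticeRep G) :=
  ⟨fun r => h (T2Space.of_injective_continuous r.injective r.continuous)⟩

/-- **Emptiness region, I′.** A non-`T₁` topological group carries no lattice representation
data. [folklore] -/
theorem isEmpty_of_not_t1Space (h : ¬ T1Space G) : IsEmpty (LatticeRep G) :=
  isEmpty_of_not_t2Space fun _ => h inferInstance

/-- The matrix algebra `M_N(ℂ)` has at most continuum many elements (`𝔠^{N²} ≤ 𝔠`). [folklore] -/
theorem mk_matrix_le_continuum (N : ℕ) : #(Matrix (Fin N) (Fin N) ℂ) ≤ 𝔠 := by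
  change #(Fin N → Fin N → ℂ) ≤ 𝔠
  rw [Cardinal.mk_arrow, Cardinal.mk_arrow]
  simp only [Cardinal.lift_id, Cardinal.mk_fin, Cardinal.mk_complex, Cardinal.power_natCast,
    ← pow_mul]
  exact Cardinal.power_nat_le Cardinal.aleph0_le_continuum

/-- A group with a faithful matrix representation has at most continuum many elements.
[folklore] -/
theorem mk_le_continuum (r : LatticeRep G) : #G ≤ 𝔠 := by
  have h₁ := Cardinal.lift_mk_le_lift_mk_of_injective r.injective
  rw [Cardinal.lift_uzero] at h₁
  refine h₁.trans ?_
  simpa only [Cardinal.lift_continuum] using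
    Cardinal.lift_le.2 (mk_matrix_le_continuum r.N)

/-- **Emptiness region, II.** A group with more than continuum many elements (whatever its
topology, e.g. discrete) carries no lattice representation data. [folklore] -/
theorem isEmpty_of_continuum_lt_card (h : 𝔠 < #G) : IsEmpty (LatticeRep G) :=
  ⟨fun r => (not_le.2 h) r.mk_le_continuum⟩

/-- **The uniform census view `∀ params, Nonempty (LatticeRep params)` is FALSE, already inside
the telescope `[Group G] [TopologicalSpace G] [IsTopologicalGroup G] [CompactSpace G]` of the
route items**: `ℤ₂ = Multiplicative (ZMod 2)` with the INDISCRETE topology is a compact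
topological group that is not `T₁`, hence has no faithful continuous matrix representation.
(So the carrier is inhabited at some parameters and empty at others; over a non-Lie compact
group every `∀ r : LatticeRep G, …` item is vacuous — by design of `IsCompactSimpleLieGroup`.)
[folklore] -/
theorem not_forall_nonempty :
    ¬ ∀ (G : Type) [Group G] [TopologicalSpace G] [IsTopologicalGroup G] [CompactSpace G],
      Nonempty (LatticeRep G) := by
  intro h
  letI : TopologicalSpace (Multiplicative (ZMod 2)) := ⊤
  haveI : ContinuousMul (Multiplicative (ZMod 2)) := ⟨continuous_top⟩
  haveI : ContinuousInv (Multiplicative (ZMod 2)) := ⟨continuous_top⟩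
  haveI : IsTopologicalGroup (Multiplicative (ZMod 2)) := {}
  obtain ⟨r⟩ := h (Multiplicative (ZMod 2))
  haveI : T2Space (Multiplicative (ZMod 2)) :=
    T2Space.of_injective_continuous r.injective r.continuous
  have hU : IsOpen (({1}ᶜ : Set (Multiplicative (ZMod 2)))) := isOpen_compl_singleton
  rcases (TopologicalSpace.isOpen_top_iff _).1 hU with h0 | h1
  · have hmem : Multiplicative.ofAdd (1 : ZMod 2) ∈ ({1}ᶜ : Set (Multiplicative (ZMod 2))) := by
      rw [mem_compl_iff, mem_singleton_iff]
      decide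
    rw [h0] at hmem
    exact hmem
  · have hmem : (1 : Multiplicative (ZMod 2)) ∈ ({1}ᶜ : Set (Multiplicative (ZMod 2))) := by
      rw [h1]; exact mem_univ _
    exact hmem rfl

/-- **The carrier implies the `[IsTopologicalGroup G]` binder (compact case).** A compact group
with a faithful continuous unitary matrix representation is a topological group: `ρ` is a closed
embedding of `G` onto a subgroup of the topological group `U(N)`. (It is also Hausdorff and
second countable: `LatticeRep.t2Space`, `LatticeRep.secondCountableTopology`.)
[cite: BrockerTomDieck1985, III (4.1)] -/
theorem isTopologicalGroup [CompactSpace G] (r : LatticeRep G) : IsTopologicalGroup G := by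
  let ρ' : G →* Matrix.unitaryGroup (Fin r.N) ℂ := r.ρ.codRestrict _ r.mem_unitary
  have hind : IsInducing ρ' :=
    (r.continuous.isClosedEmbedding r.injective).isInducing.codRestrict r.mem_unitary
  exact hind.topologicalGroup ρ'

end Obstructions

/-! ### Witnesses: the standard inhabitants -/

section Witnesses

variable {G H : Type*} [Group G] [TopologicalSpace G] [Group H] [TopologicalSpace H]

/-- **Pull-back** of lattice representation data along a continuous injective homomorphism
`f : H →* G`: `ρ ∘ f`. [folklore] -/
def comap (r : LatticeRep G) (f : H →* G) (hf : Continuous f) (hinj : Injective f) :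
    LatticeRep H :=
  ⟨r.N, r.ρ.comp f, r.continuous.comp hf, r.injective.comp hinj, fun h => r.mem_unitary (f h)⟩

/-- The pull-back has the same degree. [folklore] -/
@[simp] theorem comap_N (r : LatticeRep G) (f : H →* G) (hf : Continuous f) (hinj : Injective f) :
    (r.comap f hf hinj).N = r.N := rfl

/-- The pull-back representation is `ρ ∘ f`. [folklore] -/
@[simp] theorem comap_ρ_apply (r : LatticeRep G) (f : H →* G) (hf : Continuous f)
    (hinj : Injective f) (h : H) : (r.comap f hf hinj).ρ h = r.ρ (f h) := rfl

/-- **Restriction to a subgroup** (with the subspace topology): every subgroup of a group with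
lattice representation data has lattice representation data (e.g. every subgroup of `U(N)`).
[cite: BrockerTomDieck1985, III (4.1)] -/
def restrict (r : LatticeRep G) (K : Subgroup G) : LatticeRep K :=
  r.comap K.subtype continuous_subtype_val Subtype.val_injective

/-- The restriction has the same degree. [folklore] -/
@[simp] theorem restrict_N (r : LatticeRep G) (K : Subgroup G) : (r.restrict K).N = r.N := rfl

/-- Subgroups inherit inhabitedness of the carrier. [folklore] -/
instance nonempty_subgroup [h : Nonempty (LatticeRep G)] (K : Subgroup G) :
    Nonempty (LatticeRep K) :=
  h.map fun r => r.restrict K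

variable (G) in
/-- **The trivial group**: the trivial one-dimensional representation of a (topologically
arbitrary) one-element group is faithful, continuous and unitary. [folklore] -/
def ofSubsingleton [Subsingleton G] : LatticeRep G :=
  ⟨1, 1, continuous_const, fun a b _ => Subsingleton.elim a b, fun _ => by simp⟩

/-- The carrier over a one-element group is inhabited. [folklore] -/
instance nonempty_of_subsingleton [Subsingleton G] : Nonempty (LatticeRep G) :=
  ⟨ofSubsingleton G⟩

/-- **`SU(N)`**: the fundamental representation (`fundamentalLatticeRep`, Bröcker–tom Dieck
I (1.10)) inhabits the carrier — the gauge groups of `YangMills`/`QCD`. [cite: BrockerTomDieck1985, I (1.10)] -/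
instance nonempty_specialUnitaryGroup (N : ℕ) :
    Nonempty (LatticeRep (Matrix.specialUnitaryGroup (Fin N) ℂ)) :=
  ⟨fundamentalLatticeRep N⟩

/-- **`U(N)`**: the defining representation (`unitaryFundamentalLatticeRep`, Bröcker–tom Dieck
I (1.9)) inhabits the carrier. [cite: BrockerTomDieck1985, I (1.9)] -/
instance nonempty_unitaryGroup (N : ℕ) :
    Nonempty (LatticeRep (Matrix.unitaryGroup (Fin N) ℂ)) :=
  ⟨unitaryFundamentalLatticeRep N⟩

/-- **`U(1) = Circle`**: the charge-one representation `z ↦ (z)` as lattice representation data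
(compact abelian lattice gauge theory). [cite: BrockerTomDieck1985, I (1.9)] -/
def circle : LatticeRep Circle :=
  ⟨1, u1Rep, continuous_u1Rep, u1Rep_injective, u1Rep_mem_unitaryGroup⟩

/-- `circle` has degree `1`. [folklore] -/
@[simp] theorem circle_N : circle.N = 1 := rfl

/-- The carrier over `U(1)` is inhabited. [folklore] -/
instance nonempty_circle : Nonempty (LatticeRep Circle) := ⟨circle⟩

/-! #### Finite groups: the regular representation by permutation matrices -/

/-- Permutation matrices are unitary: `P_σ P_σ* = P_σ P_{σ⁻¹} = P_{σ⁻¹σ} = 1`. [cite: Serre1977, §1.3] -/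
theorem permMatrix_mem_unitaryGroup {n : Type*} [DecidableEq n] [Fintype n] (σ : Equiv.Perm n) :
    σ.permMatrix ℂ ∈ Matrix.unitaryGroup n ℂ := by
  rw [Matrix.mem_unitaryGroup_iff, Matrix.star_eq_conjTranspose, Matrix.conjTranspose_permMatrix,
    ← Matrix.permMatrix_mul, inv_mul_cancel, Matrix.permMatrix_one]

/-- `σ ↦ P_{σ⁻¹}` (Mathlib's `Matrix.permMatrixHom`) is injective. [folklore] -/
theorem permMatrixHom_injective {n : Type*} [DecidableEq n] [Fintype n] :
    Injective (Matrix.permMatrixHom (n := n) (R := ℂ)) := by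
  intro σ τ h
  simp only [Matrix.permMatrixHom_apply] at h
  have hP : σ⁻¹.toPEquiv = τ⁻¹.toPEquiv := PEquiv.toMatrix_injective h
  have hστ : σ⁻¹ = τ⁻¹ := by
    ext x
    have hx := congrArg (fun f : n ≃. n => f x) hP
    simpa [Equiv.toPEquiv_apply] using hx
  exact inv_injective hστ

/-- Re-indexing a unitary matrix along an equivalence of index types keeps it unitary. [folklore] -/
theorem reindex_mem_unitaryGroup {m n : Type*} [Fintype m] [DecidableEq m] [Fintype n]
    [DecidableEq n] (e : m ≃ n) {A : Matrix m m ℂ} (hA : A ∈ Matrix.unitaryGroup m ℂ) :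
    Matrix.reindex e e A ∈ Matrix.unitaryGroup n ℂ := by
  rw [Matrix.mem_unitaryGroup_iff] at hA ⊢
  rw [Matrix.star_eq_conjTranspose, Matrix.conjTranspose_reindex, Matrix.reindex_apply,
    Matrix.reindex_apply, Matrix.submatrix_mul_equiv, ← Matrix.star_eq_conjTranspose, hA,
    Matrix.submatrix_one_equiv]

variable (G) in
/-- **The regular representation of a finite group as lattice representation data**:
`g ↦` the permutation matrix of left translation by `g` on `G` (re-indexed by `Fin |G|`), in the
DISCRETE topology — faithful (Serre §1.2 (b)), unitary (permutation matrices), continuous. Every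
finite group is a zero-dimensional compact Lie group (Bröcker–tom Dieck I (1.15)); this covers the
finite gauge groups `ℤ_N` of lattice gauge theory. [cite: Serre1977, §1.2 (b)] [cite: BrockerTomDieck1985, I (1.15)] -/
def regular [Fintype G] [DecidableEq G] [DiscreteTopology G] : LatticeRep G where
  N := Fintype.card G
  ρ := ((Matrix.reindexRingEquiv ℂ (Fintype.equivFin G)).toMulEquiv.toMonoidHom.comp
      (Matrix.permMatrixHom (n := G) (R := ℂ))).comp (MulAction.toPermHom G G)
  continuous := continuous_of_discreteTopology
  injective :=
    (Matrix.reindexRingEquiv ℂ (Fintype.equivFin G)).injective.comp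
      (permMatrixHom_injective.comp MulAction.toPerm_injective)
  mem_unitary g :=
    reindex_mem_unitaryGroup (Fintype.equivFin G)
      (permMatrix_mem_unitaryGroup (MulAction.toPerm g)⁻¹)

/-- The regular lattice representation has degree `|G|`. [folklore] -/
@[simp] theorem regular_N [Fintype G] [DecidableEq G] [DiscreteTopology G] :
    (regular G).N = Fintype.card G := rfl

/-- The regular lattice representation sends `g` to the (re-indexed) permutation matrix of
`(g • ·)⁻¹` (Mathlib's `permMatrixHom` convention `σ ↦ P_{σ⁻¹}`). [folklore] -/
theorem regular_ρ_apply [Fintype G] [DecidableEq G] [DiscreteTopology G] (g : G) :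
    (regular G).ρ g = Matrix.reindex (Fintype.equivFin G) (Fintype.equivFin G)
      ((MulAction.toPerm g)⁻¹.permMatrix ℂ) := rfl

/-- The carrier over a finite discrete group is inhabited. [cite: BrockerTomDieck1985, I (1.15)] -/
instance nonempty_of_finite [Finite G] [DiscreteTopology G] : Nonempty (LatticeRep G) := by
  classical
  haveI := Fintype.ofFinite G
  exact ⟨regular G⟩

/-! #### Products: block-diagonal direct sums -/

/-- A block-diagonal matrix of unitaries is unitary. [folklore] -/
theorem fromBlocks_mem_unitaryGroup {m n : Type*} [Fintype m] [DecidableEq m] [Fintype n]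
    [DecidableEq n] {A : Matrix m m ℂ} {D : Matrix n n ℂ} (hA : A ∈ Matrix.unitaryGroup m ℂ)
    (hD : D ∈ Matrix.unitaryGroup n ℂ) :
    Matrix.fromBlocks A 0 0 D ∈ Matrix.unitaryGroup (m ⊕ n) ℂ := by
  rw [Matrix.mem_unitaryGroup_iff] at hA hD ⊢
  rw [Matrix.star_eq_conjTranspose, Matrix.fromBlocks_conjTranspose, Matrix.fromBlocks_multiply,
    ← Matrix.star_eq_conjTranspose, ← Matrix.star_eq_conjTranspose, hA, hD]
  simp

/-- The block-diagonal homomorphism `(g, h) ↦ ρ(g) ⊕ ρ'(h)` of two matrix representations.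
[folklore] -/
def blockDiagHom (r : LatticeRep G) (s : LatticeRep H) :
    G × H →* Matrix (Fin r.N ⊕ Fin s.N) (Fin r.N ⊕ Fin s.N) ℂ where
  toFun p := Matrix.fromBlocks (r.ρ p.1) 0 0 (s.ρ p.2)
  map_one' := by simp
  map_mul' p q := by simp [Matrix.fromBlocks_multiply]

/-- `blockDiagHom` evaluates to the block-diagonal matrix. [folklore] -/
@[simp] theorem blockDiagHom_apply (r : LatticeRep G) (s : LatticeRep H) (p : G × H) :
    r.blockDiagHom s p = Matrix.fromBlocks (r.ρ p.1) 0 0 (s.ρ p.2) := rfl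

/-- The block-diagonal homomorphism re-indexed by `Fin (N + N')`. [folklore] -/
def prodHom (r : LatticeRep G) (s : LatticeRep H) :
    G × H →* Matrix (Fin (r.N + s.N)) (Fin (r.N + s.N)) ℂ :=
  (Matrix.reindexRingEquiv ℂ
      (finSumFinEquiv : Fin r.N ⊕ Fin s.N ≃ Fin (r.N + s.N))).toMulEquiv.toMonoidHom.comp
    (r.blockDiagHom s)

/-- `prodHom` evaluates to the re-indexed block-diagonal matrix. [folklore] -/
@[simp] theorem prodHom_apply (r : LatticeRep G) (s : LatticeRep H) (p : G × H) :
    r.prodHom s p = Matrix.reindex (finSumFinEquiv : Fin r.N ⊕ Fin s.N ≃ Fin (r.N + s.N))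
      finSumFinEquiv (Matrix.fromBlocks (r.ρ p.1) 0 0 (s.ρ p.2)) := rfl

/-- **Direct sum**: the product `G × H` of two groups with lattice representation data carries
the block-diagonal representation `ρ ⊕ ρ'` (re-indexed by `Fin (N + N')`), again faithful,
continuous and unitary — e.g. `U(1) × SU(2) × SU(3)`. [folklore] -/
def prod (r : LatticeRep G) (s : LatticeRep H) : LatticeRep (G × H) where
  N := r.N + s.N
  ρ := r.prodHom s
  continuous := by
    have h : Continuous fun p : G × H =>
        Matrix.reindex (finSumFinEquiv : Fin r.N ⊕ Fin s.N ≃ Fin (r.N + s.N)) finSumFinEquiv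
          (Matrix.fromBlocks (r.ρ p.1) 0 0 (s.ρ p.2)) :=
      ((r.continuous.comp continuous_fst).matrix_fromBlocks continuous_const continuous_const
        (s.continuous.comp continuous_snd)).matrix_reindex _ _
    exact h.congr fun p => (prodHom_apply r s p).symm
  injective p q hpq := by
    rw [prodHom_apply, prodHom_apply] at hpq
    have h := Matrix.fromBlocks_inj.1 ((Matrix.reindex _ _).injective hpq)
    exact Prod.ext (r.injective h.1) (s.injective h.2.2.2)
  mem_unitary p := by
    rw [prodHom_apply]
    exact reindex_mem_unitaryGroup _
      (fromBlocks_mem_unitaryGroup (r.mem_unitary p.1) (s.mem_unitary p.2))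

/-- The direct sum has degree `N + N'`. [folklore] -/
@[simp] theorem prod_N (r : LatticeRep G) (s : LatticeRep H) : (r.prod s).N = r.N + s.N := rfl

/-- Products inherit inhabitedness of the carrier. [folklore] -/
instance nonempty_prod [hG : Nonempty (LatticeRep G)] [hH : Nonempty (LatticeRep H)] :
    Nonempty (LatticeRep (G × H)) :=
  hG.elim fun r => hH.map fun s => r.prod s

end Witnesses

/-! ### The census views -/

section Census

/-- **The existential census view holds inside the items' telescope**: there is a compact
topological group whose carrier `LatticeRep G` is inhabited — e.g. `SU(2)` with its fundamental
representation. [cite: BrockerTomDieck1985, I (1.10)] -/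
theorem exists_nonempty :
    ∃ (G : Type) (_ : Group G) (_ : TopologicalSpace G),
      IsTopologicalGroup G ∧ CompactSpace G ∧ Nonempty (LatticeRep G) :=
  ⟨Matrix.specialUnitaryGroup (Fin 2) ℂ, inferInstance, inferInstance, inferInstance,
    inferInstance, inferInstance⟩

variable {G : Type*} [Group G] [TopologicalSpace G] [CompactSpace G]

/-- For items guarded by `IsCompactSimpleLieGroup G →`, the binder `∀ r : LatticeRep G` is never
vacuous relative to the guard: linearity is its second conjunct. [folklore] -/
theorem nonempty_of_isCompactSimpleLieGroup (h : IsCompactSimpleLieGroup G) :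
    Nonempty (LatticeRep G) :=
  h.2

/-- Whether the guard `IsCompactSimpleLieGroup G` is itself inhabited rests on the tree's named
fact `isSimpleCompactGroup_specialUnitaryGroup` (simplicity of `SU(n)`, `n ≥ 2`): given it,
`SU(2)` is a compact simple Lie group with inhabited carrier. [cite: BrockerTomDieck1985, I (1.10) and V (7.13)] -/
theorem exists_isCompactSimpleLieGroup_of (h : isSimpleCompactGroup_specialUnitaryGroup.{0}) :
    ∃ (G : Type) (_ : Group G) (_ : TopologicalSpace G) (_ : CompactSpace G),
      IsTopologicalGroup G ∧ IsCompactSimpleLieGroup G ∧ Nonempty (LatticeRep G) :=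
  ⟨Matrix.specialUnitaryGroup (Fin 2) ℂ, inferInstance, inferInstance, inferInstance,
    inferInstance, isCompactSimpleLieGroup_specialUnitaryGroup h le_rfl, inferInstance⟩

end Census

end LatticeRep

end Literature.MathematicalPhysics.QuantumFieldTheory

end
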